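import Summits.BirchSwinnertonDyer.Rank1Residual.O5.O5CompanionTransport
import HarnessLib

/-!
# O5 — GEN 4: the OLD-LINE CONGRUENCE law T16 (one zero-parameter law behind T9-LocIrr, T12, T14, T14♯, T15)
# and the kernel-checked linear-algebra core of its proof route

Add-on to `O5CompanionTransport` (gen 3, p263520: `IsCompanionAtThree`, T14/T14♯, `normLiftThree`, T15) and
`O5DepletedCongruence` (T13, `depletedElementThree`, `eulerElementInvThree`).  Census cell O5 = (t′), o5-r1 GEN 4
(planner-b2b-bsdres-o5-r1-g4-0, 2026-08-21).  HONEST FRAMING: every node is a `def … : Prop` (THEOREM-CANDIDATE with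
printed sources) or an `@[conjecture] def` (census-mined law); census numbers are EVIDENCE; nothing is asserted or
booked; no main conjecture is an input of anything here (pure modular-symbol arithmetic); the two `theorem`s are
elementary linear algebra / bookkeeping.  Details: `HOME/cells/o5o6/TARGETS.md` §O5 '#### o5-r1 GEN 4',
pre-registration + RESULT `HOME/b2b-bsdres-o5-r1/gen4/T16-PREREG.md`.

## G4-1 THE LAW
`D̄^ε_{S,n}(W) = c · ν_{n−1→n} D̄^ε_{S,n−1}(G)` for GOOD companions `G` (ordinary: gives T15/T14♯/T14; supersingular
= the LocIrr rows: the T9-LocIrr template IS Kobayashi–Pollack `λ^±(G)` shifted one layer), for EVERY layer after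
the FAMILY scaling `3^{−μ*}` (`μ* = min_m μ(θ^ε_m)`), one scalar `c` per (pair, branch); for MULTIPLICATIVE
companions the same with the TELESCOPED element `Σ_k u^k ν^{(k)} θ_{n−1−k}(h) + (bottom)` (gen 3's "T15 fails for
multiplicative companions at relative degree `2·3^{n−2}`" was the `k = 1` term).  T15 AS LANDED compares with
`μ(D_n(W))` instead of the family `μ*`, which over-asks (a relative mod-9 congruence) on layers where depletion
kills the element mod 3 — a regime its evidence never tested; the family form T15′ below is the one T16 implies.

## G4-2 STRUCTURAL ORIGIN (proof route; inputs I1–I5, none a main conjecture)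
In `H¹(X₀(9L·), 𝔽₃)^ε_𝔪` the two `U₃`-killed `g`-old classes are `e₁ = (3Φ_{g|B₃})‾` and `e₂ = (9Φ_{g|B₉})‾`;
multiplicity two (o5-r2 F-O5-M2, all 85 certified O5 rows) says `H¹[𝔪] = ⟨e₁, e₂⟩ ∋ Φ̄_f`; `W₉` fixes `e₁` and
carries `e₂` to the non-torsion class `e₀ = Φ̄_g`; Ihara makes `e₀, e₁, e₂` independent; so the `W₉`-eigen class
`Φ̄_f` is a multiple of `e₁` (`oldLine_coefficient_vanishes`, PROVED), whose `3`-power-cusp periods are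
`ν θ̄_{n−1}(g)`.  `μ(𝔪) = 2` ⇒ pot-good ⇒ peu ramifié (`PeuRamifieCompanionLawThree`) ⇒ by Ribet every III* row HAS a
level-prime-to-3 weight-2 companion newform (class-level form of the law; the census sees the `𝔽₃`-rational ones).

## G4-3 EVIDENCE
LOCAL derivation set (40 pilot pairs of kit j129977, zero parameters, `n = 0…6`, both branches): 229 exact +
215 both-zero / 444 layer instances, 0 deviations, signs constant 80/80.  PRE-REGISTERED HELD-OUT kit j130904
(42 new pairs disjoint in `W` and in companion class): PASS on all three strata — generic-III* ~ good-ordinary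
105 exact (18/18 pairs), multiplicative 56 (10/10), LocIrr-III* ~ good-SUPERSINGULAR 69 (14/14; + 12 post hoc on
2 pairs with `a₃ = −3`); 0 kills.  Side laws: P-peu 22/22, P-split0 11/11, NonSplit 129/129.  The Atkin–Lehner sign
at 9 is UNINFORMATIVE: `w₃ = (−2|3) = +1` on all 191 Kodaira III/III* rows seen (Rohrlich/Kobayashi), so the sign
of `c` is not the `W₉`-eigenvalue (open).

## TYPER PLACEMENT NOTE (cc-typer-5 GEN 4, typer of record O5 §3.5 / O6 §3.4, 2026-08-21)
Landed from o5-r1 GEN 4's FROZEN file `HOME/b2b-bsdres-o5-r1/gen4/O5OldLine.lean` (sha16 374f1ccbd866faf8 =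
`gen4/O5OldLine.374f1ccbd866faf8.lean`, 360 lines; ASK A-O5-16 FINAL 12:00Z, superseding d77c2244… / ce9286cd…)
VERBATIM below this note, except ONE lint-only cite-key correction (`Serre1987Duke` → `Serre1987`, the tree's references.bib key for
Serre, Duke Math. J. 54 (1987) 179–230; no other token touched). TYPER CHECK: T15′
`ModThreeLayerTransportFamilyThree` RESTATES the landed T15 `ModThreeLayerTransportThree` (p263520) with the family
threshold — SUPERSEDE, never re-word: T15 keeps its statement and gets a doc-only caveat banner pointing here; T16
`OldLineCongruenceThree` (+ `OldLineBottomLayerThree`, `OldLineCongruenceMultThree`,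
`SplitCompanionBottomVanishesThree`, `VisibleFactorAtNineThree`) are `@[conjecture]` EVIDENCE items (T16
PRE-REGISTERED `gen4/T16-PREREG.md` and PASSED on the held-out kit j130904; T16-mult free-`t` sector PASSED kit
j131342); `PeuRamifieCompanionLawThree` is a THEOREM-CANDIDATE (plain `def … : Prop`, Serre 1987 §2.8 / Edixhoven —
to be proved, never consumed as a hypothesis); `depleteThree` / `bottomElementThree` / `teleElementThree` are
definitions with bodies; `oldLine_coefficient_vanishes` / `oldLine_of_eigen` are PROVED linear algebra whose five
INPUTS I1–I5 are NAMED in the docstring, not typed (each a theorem-candidate about `H¹(X₀(9L), 𝔽₃)`; I2 = o5-r2's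
`MultGeTwoAtNineOfPotGood` in equality form, cross-node `O5/MultiplicityAtNine`). DEDUP STANCE (typer of record):
T16 is offered by its author as the ONE law behind T9-LocIrr / T12 / T14 / T14♯ / T15 — recorded; the earlier nodes
stay as landed (siblings with their own evidence lines); the implications that are kernel facts are the proved
`modThreeLayerTransportFamily_of_oldLine` here and `companionLambdaTransportLawThree_of_exact` (p263520); no node is
retired by this landing. Audit marks expected: `conjecture` 6, `vendored-fact` 1 (`PeuRamifieCompanionLawThree`),
`orphan` on the proved lemmas. 0 named Literature facts; census numbers are EVIDENCE; nothing booked; no mark of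
`RESIDUAL-MAP.md` moves.
-/

set_option autoImplicit false

noncomputable section

open scoped Classical MatrixGroups ModularForm NumberField

open CongruenceSubgroup Polynomial WeierstrassCurve NumberField Literature.NumberTheory.EllipticCurves
  Literature.NumberTheory.EllipticCurves.ModularForms
  Summit.BirchSwinnertonDyer.Rank1Residual.Additive

namespace Summit.BirchSwinnertonDyer.Rank1Residual.O5

/-! ## §0 T15′ — the FAMILY form of T15 (restated threshold; the per-layer shadow of T16) -/

/-- **T15′ `ModThreeLayerTransportFamilyThree` (CONJECTURE; restatement of the landed T15 with the FAMILY
threshold).**  As `ModThreeLayerTransportThree` (generic type-III* `W`, ordinary good companion `G`), but the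
conclusion "subtracting `c·ν(D_{n−1}(G))` raises the content valuation" is measured against the family minimum
`μ*_W = min_m μ(θ^ε_m(W))` ("`∃ m, μ(θ_m(W)) < μ(difference)`"), not against `μ(D_n(W))`: on layers where
`S`-depletion already kills `D_n(W)` mod `3^{μ*+1}` the landed form asks for a relative mod-9 congruence that no
evidence addresses, whereas this form is exactly what the 84/84 (gen 3) and 105/105 + 69/69 (gen 4 held-out)
coefficient identities certify.  Implied by T16 (`modThreeLayerTransportFamily_of_oldLine`).
[evidence: census cell O5, o5-r1 GEN 3/4: kit j129977 84/84, held-out kit j130904 stratum A 105/105, 0 dev]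
[cite: MazurTate1987, §1] [cite: GreenbergVatsal2000, §2] -/
@[conjecture] def ModThreeLayerTransportFamilyThree : Prop :=
  ∀ (W G : WeierstrassCurve ℚ) [W.IsElliptic] [W.IsGloballyMinimal] [NeZero (W.conductorNorm ℤ)]
    [G.IsElliptic] [G.IsGloballyMinimal] [NeZero (G.conductorNorm ℤ)]
    (f : CuspForm (Gamma0 (W.conductorNorm ℤ)) 2) (g : CuspForm (Gamma0 (G.conductorNorm ℤ)) 2),
    IsNewformOf W f → IsNewformOf G g → ClassO5 W 3 → SubTprime W 3 → padicValRat 3 W.Δ = 9 →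
    Kato2004.ImageContainsSL2 W 3 → ¬ LocIrr W 3 → IsCompanionAtThree W G → ¬ 3 ∣ G.conductorNorm ℤ →
    ¬ ((3 : ℤ) ∣ G.LFunction 3) →
    ∀ ε : Bool, ∃ n₀ : ℕ, ∀ n : ℕ, n₀ ≤ n →
      depletedElementThree ((W.conductorNorm ℤ * G.conductorNorm ℤ).primeFactors.erase 3) W f ε n ≠ 0 →
      ∃ c : ℚ, ∃ m : ℕ,
        polyMuThree (branchElementThree f ε m)
          < polyMuThree
              (depletedElementThree ((W.conductorNorm ℤ * G.conductorNorm ℤ).primeFactors.erase 3) W f ε n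
                - C c * normLiftThree n
                    (depletedElementThree ((W.conductorNorm ℤ * G.conductorNorm ℤ).primeFactors.erase 3)
                      G g ε (n - 1)))

/-! ## §1 T16: the OLD-LINE CONGRUENCE law (zero-parameter, ALL layers, ordinary / supersingular /
## multiplicative companions alike; supersedes T15 and explains T9-LocIrr, T14, T14♯) and its linear-algebra core -/

/-- `S`-depletion of an arbitrary layer-`n` element `P ∈ ℚ[Γ_n]` by the Euler factors OF THE CURVE `E`
(`depletedElementThree S E f ε n = depleteThree S E ε n (branchElementThree f ε n)`). [cite: GreenbergVatsal2000, §2] -/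
noncomputable def depleteThree (S : Finset ℕ) (E : WeierstrassCurve ℚ) [E.IsElliptic] (ε : Bool) (n : ℕ)
    (P : ℚ[X]) : ℚ[X] :=
  (P * ∏ ℓ ∈ S, eulerElementInvThree E ε ℓ n) %ₘ ((X + 1) ^ (3 ^ n) - 1)

/-- The **layer `−1` element** of a form `g` on branch `ε`: `θ^+_{−1}(g) := 2·[0]⁺_g = 2 L(g,1)/Ω⁺_g ∈ ℚ = ℚ[Γ₀]`
(the class the norm relation one step BELOW layer `0` produces: for a form `φ` with `U₃ φ = 0`,
`θ₀(φ) = −ν_{−1→0} θ_{−1}(φ)`), and `0` on the odd branch. [cite: MazurTate1987, §1 (1.3)] -/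
noncomputable def bottomElementThree {N : ℕ} (g : CuspForm (Gamma0 N) 2) (ε : Bool) : ℚ[X] :=
  if ε then C (2 * ratPlusSymbol g 0) else 0

/-- The **telescoped old-line element** of a `3`-STABILISED form `h` (level `3M`, `U₃ h = u·h`, `u = a₃(h) = ±1`):
`Ψ_n := θ_n(h) + u·ν_{n−1→n} Ψ_{n−1}`, `Ψ_{−1} := t`.  MEANING (ours): `ρ̄ = ρ̄_h` is finite flat at `3`
(`PeuRamifieCompanionLawThree`), so by level lowering at `p = 3` [Ribet1990, Thm. 1.1; Edixhoven1992, Thm. 4.5]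
there is a weight-2 mod-3 `T₃`-eigensymbol `Ψ̄` of level `M = N_h/3` with `a₃(Ψ̄) = u`; on the integral old
classes `Ψ̄, Ψ̄′ := (3·Ψ|B₃)‾` one has `U₃Ψ̄ = uΨ̄ − Ψ̄′`, `U₃Ψ̄′ = 0`, so the `U₃ = u` line is `Ψ̄ − uΨ̄′` (`= Φ̄_h`
by multiplicity one at `3 ∥ 3M`) and the `U₃ = 0` line is `Ψ̄′` (where `Φ̄_{f_W}` lives); since
`θ_n(Ψ̄′) = ν θ_{n−1}(Ψ̄)`, `θ̄_n(h) = Ψ̄_n − u ν Ψ̄_{n−1}` with `Ψ̄_n = θ̄_n(Ψ̄)` — the recursion above, mod 3 —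
and `t = Ψ̄⁺({0,∞})` is the BOTTOM VALUE OF `Ψ̄`: `θ̄⁺_{−1}(h) = (1 − u)·t`, i.e. `t = −θ̄⁺_{−1}(h)` for `u = −1`,
while for `u = +1` the law forces `θ̄⁺_{−1}(h) = 0` (`SplitCompanionBottomVanishesThree`) and `t` is NOT readable
from `h` (it is from `Ψ̄`: kit j131342 finds `t ≠ 0` on 14/14 split pairs where §6's layer-0 shadow forces it, `t = 0` on 17 others).
Consistency: `Ψ̄_n` satisfies the good-reduction relation `π Ψ̄_n = u Ψ̄_{n−1} − ν Ψ̄_{n−2}` BECAUSE `u² = 1`.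
[cite: MazurTate1987, §1 (1.3)] [cite: AtkinLehner1970, Thm. 5] -/
noncomputable def teleElementThree {N : ℕ} (h : CuspForm (Gamma0 N) 2) (ε : Bool) (u t : ℚ) : ℕ → ℚ[X]
  | 0 => branchElementThree h ε 0 + C (u * t)
  | n + 1 => branchElementThree h ε (n + 1) + C u * normLiftThree (n + 1) (teleElementThree h ε u t n)

/-- **T16 `OldLineCongruenceThree` (CONJECTURE, census law; zero free parameters; EVIDENCE-labelled; the
held-out test kit j130904 is pre-registered in `gen4/T16-PREREG.md`).**  Let `W ∈ O5b` at `3` (class O5,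
sub-class (t′)) with `SL₂(𝔽₃) ⊆ im ρ̄_{W,3}`, and let `G` be an elliptic companion with GOOD reduction at `3`
(`3 ∤ N_G`; ordinary OR supersingular — by `CompanionTypeLawThree` the supersingular case is exactly the
`LocIrr` case), `S` = the primes `≠ 3` of `N_W N_G`.  Then on each branch `ε` there is ONE scalar `c ∈ ℚ^×`
(`|c|₃ = 3^{μ*_G − μ*_W}`, `μ*` = the family `μ` = `min_m μ(θ^ε_m)`; its unit part a SIGN) such that for EVERY
layer `n ≥ 1`
  `D^ε_{S,n}(W) ≡ c · ν_{n−1→n}( D^ε_{S,n−1}(G) )   (mod 3^{μ*_W + 1})`,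
i.e. after the family scaling the mod-3 layer-`n` depleted element of the potentially-supersingular newform IS
the norm lift of the companion's layer-`(n−1)` depleted element (for `ε = −`, `n = 0` reads `D̄₀ = 0`; for
`ε = +` the layer-0 companion of the law uses `bottomElementThree`, see `OldLineBottomLayerThree`).
STRUCTURAL ORIGIN (ours; the proof route is `oldLine_coefficient_vanishes` below + five named inputs): in
`H¹(X₀(9L), 𝔽₃)^ε[𝔪]` (`𝔪` = the non-Eisenstein maximal ideal of `ρ̄`, `U₃ ∈ 𝔪`) the two `g`-old classes
killed by `U₃` are `e₁ = (3·Φ_{g|B₃})‾` — whose `3`-power-cusp periods are EXACTLY `ν θ̄_{n−1}(g)` — and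
`e₂ = (9·Φ_{g|B₉})‾`; o5-r2's multiplicity census (F-O5-M2: `μ(𝔪) = 2` on all 85 certified O5 rows
`N ≤ 1600`) says `H¹[𝔪] = ⟨e₁, e₂⟩`; `W₉` fixes `e₁` and carries `e₂` to the non-torsion old class `e₀ = Φ̄_g`,
so a `W₉`-EIGEN class in `⟨e₁, e₂⟩` — such as `Φ̄_{f_W}` — is a multiple of `e₁`.  CONSEQUENCES: T15/T14♯/T14
(ordinary `G`: `λ(ν x) = 2·3^{n−1} + λ(x)`); the LocIrr template of T9 with `b = 2`
(`λ(θ^ε_n(W)) = 2·3^{n−1} + q_{n−1} + λ^∓…` = Kobayashi–Pollack `λ^±` of the supersingular companion shifted one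
layer: "the signed objects of a LocIrr row are the companion's `L^±₃`"); `μ`-transport (T12 mechanism).
CENSUS (LOCAL re-score of the 40 pilot pairs of kit j129977 with the zero-parameter law, all layers
`n = 0…6`, both branches, `gen4/T16-LOCAL.txt`): ordinary companions 157 exact + 155 both-zero / 312 layer
instances, 0 deviations, 0 one-sided zeros, sign constant on 80 / 80 (pair, branch); the held-out job adds
18 generic-III* ~ good-ordinary pairs of companion conductor ≤ 12 000 (all of analytic rank 2) and — NEW — 16
LocIrr-III* ~ good-SUPERSINGULAR pairs.  KILL: one coefficient deviation or one-sided zero on a CG-verified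
pair at a `μ`-stabilised layer.  Why it might fail: `μ(𝔪) = 3` at some deeper level-raising configuration
(then `Φ̄_f ∈ ⟨e₁, e₂, ?⟩` and the `W₉`-argument needs the third class), or the Ihara-type independence of
`e₀, e₁, e₂` failing mod `3` when `ρ̄` is exceptional at an `S`-prime.
[evidence: census cell O5, o5-r1 GEN 4: T16-LOCAL 157/157 decided ordinary instances exact, 0 dev]
[evidence: census cell O5, o5-r1 GEN 4, pre-registered held-out kit j130904 (frozen scorer 2409d060…, output ce0e0024…): PASS — stratum A (18 generic-III* ~ good-ordinary pairs, N_G ≤ 11 675) 105/105 decided layer instances exact + 99 both-zero; stratum C (14 LocIrr-III* ~ good-SUPERSINGULAR pairs) 69/69 exact + 87 both-zero (+ 12/12 post hoc on 2 pairs with a₃(G) = −3); 0 deviations, 0 one-sided zeros, signs constant]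
[cite: MazurTate1987, §1] [cite: GreenbergVatsal2000, §2] [cite: EmertonPollackWeston2006, Thm. 1]
[cite: Ribet1990, Thm. 1.1 (level lowering: the companion newform exists since ρ̄ is finite at 3 — G3-1 (C))]
[cite: AtkinLehner1970, Lemmas 25–27 (W_q on oldforms)] -/
@[conjecture] def OldLineCongruenceThree : Prop :=
  ∀ (W G : WeierstrassCurve ℚ) [W.IsElliptic] [W.IsGloballyMinimal] [NeZero (W.conductorNorm ℤ)]
    [G.IsElliptic] [G.IsGloballyMinimal] [NeZero (G.conductorNorm ℤ)]
    (f : CuspForm (Gamma0 (W.conductorNorm ℤ)) 2) (g : CuspForm (Gamma0 (G.conductorNorm ℤ)) 2),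
    IsNewformOf W f → IsNewformOf G g → ClassO5 W 3 → SubTprime W 3 → Kato2004.ImageContainsSL2 W 3 →
    IsCompanionAtThree W G → ¬ 3 ∣ G.conductorNorm ℤ →
    ∀ ε : Bool, ∃ c : ℚ, ∀ n : ℕ, 1 ≤ n →
      ∃ m : ℕ, polyMuThree (branchElementThree f ε m)
        < polyMuThree
            (depletedElementThree ((W.conductorNorm ℤ * G.conductorNorm ℤ).primeFactors.erase 3) W f ε n
              - C c * normLiftThree n
                  (depletedElementThree ((W.conductorNorm ℤ * G.conductorNorm ℤ).primeFactors.erase 3)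
                    G g ε (n - 1)))

/-- **T16, layer 0 (`OldLineBottomLayerThree`; CONJECTURE, EVIDENCE-labelled) — the `L`-VALUE layer.**  Same
setting, even branch, WITH THE SAME `c` as in `OldLineCongruenceThree` (typed jointly: one `c` serves `n = 0`
with the companion's `θ⁺_{−1} = 2L(G,1)/Ω⁺_G` and all `n ≥ 1`):
`D⁺_{S,0}(W) ≡ c · E_S(G; layer 0) · 2 L(G,1)/Ω⁺_G (mod 3^{μ*_W+1})`.  Since `a₃(W) = 0` gives
`θ⁺₀(W) = −ν_{−1→0}(2 L(W,1)/Ω⁺_W)`, this is a DIVISIBILITY TRANSFER between `L(W,1)/Ω_W` and `L(G,1)/Ω_G` through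
the depleting Euler factors — the r0 BSD-facing layer of the law (pilot: `r_G ≥ 1 ⟹ 3 ∣` the family-scaled
`2[0]⁺_W·E_S`, 26 / 26; held-out 39 / 39; census-WIDE over `cong-eng2-links.tsv` × `allbsd`: the `L(G,1) = 0` corollary
`VisibleFactorAtNineThree` (§6) holds on 6 848 / 6 848 parity-unforced pairs and has 0 genuine exceptions in 40 938 predicted pairs).
[evidence: census cell O5, o5-r1 GEN 4: T16-LOCAL layer 0 included in the 157 + 155 tally, 0 dev]
[cite: MazurTate1987, §1 (1.3)] -/
@[conjecture] def OldLineBottomLayerThree : Prop :=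
  ∀ (W G : WeierstrassCurve ℚ) [W.IsElliptic] [W.IsGloballyMinimal] [NeZero (W.conductorNorm ℤ)]
    [G.IsElliptic] [G.IsGloballyMinimal] [NeZero (G.conductorNorm ℤ)]
    (f : CuspForm (Gamma0 (W.conductorNorm ℤ)) 2) (g : CuspForm (Gamma0 (G.conductorNorm ℤ)) 2),
    IsNewformOf W f → IsNewformOf G g → ClassO5 W 3 → SubTprime W 3 → Kato2004.ImageContainsSL2 W 3 →
    IsCompanionAtThree W G → ¬ 3 ∣ G.conductorNorm ℤ →
    ∃ c : ℚ,
      (∃ m : ℕ, polyMuThree (branchElementThree f true m)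
        < polyMuThree
            (depletedElementThree ((W.conductorNorm ℤ * G.conductorNorm ℤ).primeFactors.erase 3) W f true 0
              - C c * depleteThree ((W.conductorNorm ℤ * G.conductorNorm ℤ).primeFactors.erase 3) G true 0
                  (bottomElementThree g true))) ∧
      ∀ n : ℕ, 1 ≤ n →
        ∃ m : ℕ, polyMuThree (branchElementThree f true m)
          < polyMuThree
              (depletedElementThree ((W.conductorNorm ℤ * G.conductorNorm ℤ).primeFactors.erase 3) W f true n
                - C c * normLiftThree n
                    (depletedElementThree ((W.conductorNorm ℤ * G.conductorNorm ℤ).primeFactors.erase 3)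
                      G g true (n - 1)))

/-- **T16-mult `OldLineCongruenceMultThree` (CONJECTURE, census law for `3`-NEW companions; EVIDENCE-labelled).**
`W` as in T16, `h` an elliptic companion with MULTIPLICATIVE reduction at `3` (`3 ∥ N_h`, `u = a₃(h) = ±1`; by
`PeuRamifieCompanionLawThree` `3 ∣ v₃(Δ_h)`), `S` the primes `≠ 3` of `N_W N_h`.  Then on each branch there are
ONE scalar `c` and ONE bottom constant `t` with, for every `n ≥ 1`,
  `D^ε_{S,n}(W) ≡ c · ν_{n−1→n}( (Ψ_{n−1})_S )  (mod 3^{μ*_W+1})`,  `Ψ_m = teleElementThree h ε u t m`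
— the norm lift of the TELESCOPED element `Σ_k u^k ν^{(k)} θ_{m−k}(h) + u^{m+1} ν_{−1→m} t` (the layer element of
the virtual `3`-old form of which `h` is the stabilisation).  This REPAIRS gen 3's reading "T15 fails for
multiplicative companions at relative degree `2·3^{n−2}`": that deviation is exactly the `k = 1` term.
CENSUS (LOCAL, 12 pilot pairs, 6 split + 6 non-split, `n = 0…6`, both branches): 72 exact + 60 both-zero / 132,
0 deviations; `t = −θ⁺_{−1}(h)` on the 6 non-split pairs, and on the 6 SPLIT pairs the law forces and the data
show `θ̄⁺_{−1}(h) = 0` (`SplitCompanionBottomVanishesThree`).  HELD-OUT (stratum B of kit j130904, 5 split + 5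
non-split new pairs): 56 exact + 56 both-zero / 112, 0 deviations ⇒ PASS.  FREE-`t` SECTOR (pre-registered kit
j131342, `gen4/TSPLIT-PREREG.md`: 14 split rank-1 companions on which the census-wide layer-0 shadow (§6) forces
`t ≠ 0`, + 6 rank-0 contrast pairs): 150 exact + 68 both-zero, 0 deviations ⇒ PASS; `t ∈ {1, 2}` on 14/14 test pairs
(first non-zero bottom constants observed), `t = 0` on 6/6 contrast pairs; `E_S(h;1)` a `3`-unit on exactly the 14.
[evidence: census cell O5, o5-r1 GEN 4: T16-LOCAL multiplicative arm 72/72 decided exact, 0 dev; held-out kit j130904 stratum B 56/56 decided exact, 0 dev; free-t kit j131342 150/150 decided exact, 0 dev, t ≠ 0 on 14/14 predicted pairs]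
[cite: MazurTate1987, §1] [cite: GreenbergVatsal2000, §2] [cite: AtkinLehner1970, Thm. 5 (p-stabilisation)] -/
@[conjecture] def OldLineCongruenceMultThree : Prop :=
  ∀ (W G : WeierstrassCurve ℚ) [W.IsElliptic] [W.IsGloballyMinimal] [NeZero (W.conductorNorm ℤ)]
    [G.IsElliptic] [G.IsGloballyMinimal] [NeZero (G.conductorNorm ℤ)]
    (f : CuspForm (Gamma0 (W.conductorNorm ℤ)) 2) (g : CuspForm (Gamma0 (G.conductorNorm ℤ)) 2),
    IsNewformOf W f → IsNewformOf G g → ClassO5 W 3 → SubTprime W 3 → Kato2004.ImageContainsSL2 W 3 →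
    IsCompanionAtThree W G → 3 ∣ G.conductorNorm ℤ →
    ∀ ε : Bool, ∃ c t : ℚ, ∀ n : ℕ, 1 ≤ n →
      ∃ m : ℕ, polyMuThree (branchElementThree f ε m)
        < polyMuThree
            (depletedElementThree ((W.conductorNorm ℤ * G.conductorNorm ℤ).primeFactors.erase 3) W f ε n
              - C c * normLiftThree n
                  (depleteThree ((W.conductorNorm ℤ * G.conductorNorm ℤ).primeFactors.erase 3) G ε (n - 1)
                    (teleElementThree g ε (G.LFunction 3 : ℚ) t (n - 1))))

/-- **P-peu `PeuRamifieCompanionLawThree` (THEOREM-CANDIDATE; EVIDENCE-labelled).**  A multiplicative-at-`3`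
elliptic companion `h` of an O5b curve `W` has `3 ∣ v₃(Δ_min(h))`: `ρ̄_W|G_{ℚ₃}` is PEU RAMIFIÉ (G3-1 (C):
`W` acquires good reduction over the tame quartic extension, so `ρ̄` is finite at `3`), and for a Tate curve
`ρ̄_h|G_{ℚ₃}` is finite at `3` iff `3 ∣ v₃(q_h) = v₃(Δ_h)` (Serre 1987 §2.8 (Prop. 5) / Edixhoven).  This is the
local input "`f_W` has a weight-2 level-`N_W/9`-type companion NEWFORM" (Ribet) used by T16's structural origin.
CENSUS: 12 / 12 pilot multiplicative companions (`v₃(Δ_h) ∈ {3, 6, 12}`) and 10 / 10 held-out ones (kit j130904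
stratum B, `v₃(Δ_h) ∈ {3, 6, 9}`): 22 / 22.
[evidence: census cell O5, o5-r1 GEN 4: 22/22 (pilot j129977 12 + held-out j130904 10)]
[cite: Serre1987, §2.8 Prop. 5 and §4.7] [cite: Edixhoven1992, Prop. 8.2] -/
def PeuRamifieCompanionLawThree : Prop :=
  ∀ (W G : WeierstrassCurve ℚ) [W.IsElliptic] [W.IsGloballyMinimal] [G.IsElliptic] [G.IsGloballyMinimal],
    ClassO5 W 3 → SubTprime W 3 → Kato2004.ImageContainsSL2 W 3 → IsCompanionAtThree W G →
    3 ∣ G.conductorNorm ℤ → (3 : ℤ) ∣ padicValRat 3 G.Δ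

/-- **P-split0 `SplitCompanionBottomVanishesThree` (CONJECTURE forced by T16-mult at `u = +1`; EVIDENCE-labelled).**
For a SPLIT multiplicative companion `h` (`a₃(h) = +1`) of an O5b curve: the family-scaled bottom value
`2 L(h,1)/Ω⁺_h` vanishes mod `3` — `3^{μ*_h} · 3 ∣ 2[0]⁺_h` with `μ*_h = min_m μ(θ⁺_m(h))`, typed as "some layer
element of `h` is strictly less `3`-divisible than `2[0]⁺_h`".  (Heuristically the finite-layer shadow of the
Mazur–Tate–Teitelbaum trivial zero together with `3 ∣ c₃(h) = v₃(Δ_h)` from `PeuRamifieCompanionLawThree`.)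
CENSUS: 6 / 6 pilot split companions and 5 / 5 held-out ones (kit j130904): 11 / 11.
[evidence: census cell O5, o5-r1 GEN 4: 11/11 (pilot 6 + held-out 5)] [cite: MazurTateTeitelbaum1986Invent, §I.15 (exceptional zero)] -/
@[conjecture] def SplitCompanionBottomVanishesThree : Prop :=
  ∀ (W G : WeierstrassCurve ℚ) [W.IsElliptic] [W.IsGloballyMinimal] [NeZero (W.conductorNorm ℤ)]
    [G.IsElliptic] [G.IsGloballyMinimal] [NeZero (G.conductorNorm ℤ)]
    (g : CuspForm (Gamma0 (G.conductorNorm ℤ)) 2),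
    IsNewformOf G g → ClassO5 W 3 → SubTprime W 3 → Kato2004.ImageContainsSL2 W 3 → IsCompanionAtThree W G →
    3 ∣ G.conductorNorm ℤ → G.LFunction 3 = 1 →
    ∃ m : ℕ, polyMuThree (branchElementThree g true m) < polyMuThree (bottomElementThree g true)

/-- T16 with one global scalar implies the per-layer family form T15′ (kernel bookkeeping). [folklore] -/
theorem modThreeLayerTransportFamily_of_oldLine (h : OldLineCongruenceThree) :
    ModThreeLayerTransportFamilyThree := by
  intro W G _ _ _ _ _ _ f g hf hg h5 hT _hΔ himg _hgen hcomp hN3 _hord ε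
  obtain ⟨c, hc⟩ := h W G f g hf hg h5 hT himg hcomp hN3 ε
  refine ⟨1, fun n hn _ => ⟨c, hc n hn⟩⟩

/-! ### The linear-algebra core of the proof route of T16 (kernel-checked; the five INPUTS are named in the
docstring — each is a theorem-candidate about `H¹(X₀(9L), 𝔽₃)`, none is a main conjecture) -/

/-- **Old-line lemma (PROVED; the skeleton of T16's proof route).**  In an `𝔽₃`-vector space `V` (read:
`H¹(X₀(9L·), 𝔽₃)^ε` localised at `𝔪`), let `e₀, e₁, e₂` be linearly independent (INPUT I1 = IHARA mod 3 at
`p = 3 ∣` level: the three degeneracy images of `H¹(X₀(L·), 𝔽₃)_𝔪` in level `9L·` are independent for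
non-Eisenstein `𝔪`), let `w` be a linear map with `w e₁ = e₁`, `w e₂ = e₀` (INPUT I3 = ATKIN–LEHNER on old classes:
`W₉ ∘ B₉ = id^*`, `W₉ ∘ B₃ = B₃ ∘ ⟨unit⟩`), and let `φ = α e₁ + β e₂` (INPUT I2 = MULTIPLICITY TWO, o5-r2 F-O5-M2
`ModPHeckeMultiplicity … = 2`: `H¹[𝔪] = ⟨e₁, e₂⟩ ∋ Φ̄_f`; that `e₁, e₂ ∈ H¹[𝔪]` is the `U₃`-computation
`U₃(Φ_{g|B₃}) = Φ_g − 3Φ_{g|B₉}·(unit)`, `U₃ Φ_{g|B₉} = Φ_{g|B₃}`) with `w φ = λ φ` (INPUT I4: `f | W₉ = ±f`).  THEN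
`β = 0`, i.e. `φ ∈ 𝔽₃ e₁`.  INPUT I5 (the translation to T16): the `3`-power-cusp periods of `e₁ = (3Φ_{g|B₃})‾` at
layer `n` form `ν_{n−1→n} θ̄_{n−1}(g)` (direct: `3·x_g(3a/3^{n+1}) = 3·x_g(a/3^n)`, and the fibres of
`(ℤ/3^{n+1})^× → (ℤ/3^n)^×` have size 3), plus `S`-depletion bookkeeping (`T_ℓ`, `ℓ ∈ S`, removed from `𝕋`).
[folklore] -/
theorem oldLine_coefficient_vanishes {V : Type*} [AddCommGroup V] [Module (ZMod 3) V]
    (e₀ e₁ e₂ φ : V) (w : V →ₗ[ZMod 3] V) (lam α β : ZMod 3)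
    (hind : LinearIndependent (ZMod 3) ![e₀, e₁, e₂])
    (hw₁ : w e₁ = e₁) (hw₂ : w e₂ = e₀) (hφ : φ = α • e₁ + β • e₂) (heig : w φ = lam • φ) :
    β = 0 := by
  have h1 : w φ = α • e₁ + β • e₀ := by rw [hφ, map_add, map_smul, map_smul, hw₁, hw₂]
  have h2 : w φ = (lam * α) • e₁ + (lam * β) • e₂ := by rw [heig, hφ, smul_add, smul_smul, smul_smul]
  have h3 : β • e₀ + (α - lam * α) • e₁ + (-(lam * β)) • e₂ = 0 := by
    have h12 : α • e₁ + β • e₀ - ((lam * α) • e₁ + (lam * β) • e₂) = 0 := sub_eq_zero.mpr (h1.symm.trans h2)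
    calc β • e₀ + (α - lam * α) • e₁ + (-(lam * β)) • e₂
        = α • e₁ + β • e₀ - ((lam * α) • e₁ + (lam * β) • e₂) := by module
      _ = 0 := h12
  have key := Fintype.linearIndependent_iff.mp hind ![β, α - lam * α, -(lam * β)]
    (by simpa [Fin.sum_univ_three] using h3) 0
  simpa using key

/-- Corollary used by T16: a nonzero `W₉`-eigen `𝔪`-torsion class is a UNIT multiple of the old line `e₁`. [folklore] -/
theorem oldLine_of_eigen {V : Type*} [AddCommGroup V] [Module (ZMod 3) V]
    (e₀ e₁ e₂ φ : V) (w : V →ₗ[ZMod 3] V) (lam α β : ZMod 3)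
    (hind : LinearIndependent (ZMod 3) ![e₀, e₁, e₂])
    (hw₁ : w e₁ = e₁) (hw₂ : w e₂ = e₀) (hφ : φ = α • e₁ + β • e₂) (heig : w φ = lam • φ) (hφ0 : φ ≠ 0) :
    φ = α • e₁ ∧ α ≠ 0 := by
  have hβ := oldLine_coefficient_vanishes e₀ e₁ e₂ φ w lam α β hind hw₁ hw₂ hφ heig
  have hφ' : φ = α • e₁ := by rw [hφ, hβ, zero_smul, add_zero]
  refine ⟨hφ', fun hα => hφ0 ?_⟩
  rw [hφ', hα, zero_smul]

/-! ## §6 Layer 0 in closed form: the VISIBLE FACTOR at `9 ∣ N` (census-wide, no kit) -/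

/-- **COROLLARY-CANDIDATE `VisibleFactorAtNineThree` (CONJECTURE; = the `L(G,1) = 0` case of
`OldLineBottomLayerThree`, see `visibleFactor_of_oldLineBottom`; EVIDENCE-labelled, census-WIDE).**
In the setting of T16 (`W ∈ O5b` at `3` with `SL₂(𝔽₃) ⊆ im ρ̄_{W,3}`, `G` an elliptic companion with `9 ∤ N_G`,
`S` = primes `≠ 3` of `N_W N_G`): if `L(G,1) = 0` then the `S`-DEPLETED bottom value of `W` is divisible by `3`
beyond the family `μ`: `3^{μ*_W + 1} ∣ E_S(W;1) · 2L(W,1)/Ω⁺_W`, `E_S(W;1) = ∏_{ℓ ∈ S} P_ℓ(W;1)`.  Its BSD shadow for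
`r_an(W) = 0` (torsion prime to `3` by surjectivity): `3 ∣ E_S(W;1) · ∏_ℓ c_ℓ(W) · Ш_an(W)`.
This is the shape of Agashe's visible-factor theorem [Agashe2010, Prop. 1.5: `q` odd, `q² ∤ N`, companion
eigenform of the SAME level with `L(g,1) = 0` ⟹ `q ∣ L(A_f,1)/Ω`] in the case his hypothesis EXCLUDES (`q = 3`,
`9 ∣ N_W`, multiplicity two at `9` — F-O5-M2) and with a companion of DIFFERENT level (whence the depleting Euler
factors at the level-changing primes); Vatsal's congruence formula [Vatsal1999] likewise assumes a free rank-one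
multiplicity-one Hecke module.  PARITY BOOKKEEPING (ours): for `ℓ ∈ S` at which `W` and `G` have different local
type, a local root-number flip forces `3 ∣ P_ℓ(W;1)` (level raising `ℓ ∤ N_W`, `a_ℓ(G) = +1`) or `3 ∣ c_ℓ(W)`
(level lowering at a split prime of `W`: `3 ∣ v_ℓ(Δ_W) = c_ℓ(W)`); with `w₃(W) = +1` (Kodaira III/III*) the number
of flips is ODD exactly when `w(G) ≠ w(W)·w₃(G)` — so for companions of ODD analytic rank (good or non-split at `3`)
and for SPLIT companions of EVEN rank the shadow is parity-forced, while for GOOD / NON-SPLIT companions of EVEN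
rank `≥ 2` nothing cheap forces it: that sector is the content (visibility of rank-2 Mordell–Weil in `Ш(W)[3]`,
`c_ℓ(W)` or an Euler factor, [CremonaMazur2000], [AgasheStein2002, Thm. 3.1]).
CENSUS (o5-r1 GEN 4, census-WIDE, no kit: cc-eng-2 `class-closure/O5/cong-eng2-links.tsv` × Cremona `allbsd`,
`a_ℓ(W)` by direct point counts; `gen4/bottom_census*.py`, `BOTTOM-CENSUS*.txt`): 4 242 `W` (Kodaira III*, `ρ̄`
surjective, a partner class semistable at `3`), 76 727 pairs.  UNFORCED sector (companion good or non-split, analytic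
rank 2): **6 848 / 6 848 pairs satisfy the shadow** (good-ordinary 3 252, good-supersingular 2 865, non-split 731),
against the rank-0-companion control rate of 'unexplained' pairs 76 % / 28 % / 6 % / 1 % at `#S = 2 / 3 / 4 / ≥ 5`
(expected ≈ 550 unexplained under no law; observed 0).  Parity-forced sector (odd companion rank, good or non-split): 34 090 / 34 099,
the 9 apparent exceptions being `ℓ ≤ 97`-screen false positives (19+ mismatching `a_ℓ mod 3` at `100 < ℓ ≤ 600`).
Split-multiplicative companions (`u = +1`, bottom constant `t` FREE ⟹ no layer-0 prediction): rank 1: 352 / 5 089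
pairs violate the shadow, all 352 genuine congruences at `ℓ ≤ 400` (so T16-mult forces `t ≠ 0` there — kit test
`gen4/TSPLIT-PREREG.md`); rank 0 or 2 (parity-forced): 4 558 / 4 558.  The NAIVE shadow without `E_S`
(`r_an(G) ≥ 1 ⟹ 3 ∣ ∏c_ℓ(W)·Ш_an(W)`) is false for 660 / 4 050 `W`: the law is intrinsically `S`-depleted.
Why it might fail: a rank-2 companion whose two independent points are invisible at every common level
(Ш(W)[3] = 0, all `c_ℓ(W)` and `P_ℓ(W;1)` prime to 3) — none in conductor `< 500 000`.
[evidence: census cell O5, o5-r1 GEN 4 (census-wide, no kit): unforced sector 6 848/6 848, parity-forced 34 090/34 099 (the 9 = screen false positives), split-companion r1 sector 352 genuine violations where the law is silent; BOTTOM-CENSUS*.txt]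
[cite: Agashe2010, Prop. 1.5] [cite: Vatsal1999, Thm. 0.3 (shape)] [cite: AgasheStein2002, Thm. 3.1]
[cite: CremonaMazur2000, §1] [cite: MazurTate1987, §1 (1.3)] -/
@[conjecture] def VisibleFactorAtNineThree : Prop :=
  ∀ (W G : WeierstrassCurve ℚ) [W.IsElliptic] [W.IsGloballyMinimal] [NeZero (W.conductorNorm ℤ)]
    [G.IsElliptic] [G.IsGloballyMinimal] [NeZero (G.conductorNorm ℤ)]
    (f : CuspForm (Gamma0 (W.conductorNorm ℤ)) 2) (g : CuspForm (Gamma0 (G.conductorNorm ℤ)) 2),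
    IsNewformOf W f → IsNewformOf G g → ClassO5 W 3 → SubTprime W 3 → Kato2004.ImageContainsSL2 W 3 →
    IsCompanionAtThree W G → ¬ 3 ∣ G.conductorNorm ℤ → ratPlusSymbol g 0 = 0 →
    ∃ m : ℕ, polyMuThree (branchElementThree f true m)
      < polyMuThree
          (depletedElementThree ((W.conductorNorm ℤ * G.conductorNorm ℤ).primeFactors.erase 3) W f true 0)

/-- Depleting the zero element gives zero. -/
theorem depleteThree_zero (S : Finset ℕ) (E : WeierstrassCurve ℚ) [E.IsElliptic] (ε : Bool) (n : ℕ) :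
    depleteThree S E ε n 0 = 0 := by
  simp [depleteThree]

/-- `OldLineBottomLayerThree ⟹ VisibleFactorAtNineThree`: when `L(G,1) = 0` the companion term of the layer-0
law vanishes (`bottomElementThree g true = C (2·0) = 0`, depletion of `0` is `0`), leaving the bare divisibility. -/
theorem visibleFactor_of_oldLineBottom (h : OldLineBottomLayerThree) : VisibleFactorAtNineThree := by
  intro W G _ _ _ _ _ _ f g hWf hGg hO5 hSub hIm hComp h3 hL
  obtain ⟨c, ⟨m, hm⟩, _⟩ := h W G f g hWf hGg hO5 hSub hIm hComp h3
  refine ⟨m, ?_⟩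
  have hb : bottomElementThree g true = 0 := by simp [bottomElementThree, hL]
  simpa [hb, depleteThree_zero] using hm

end Summit.BirchSwinnertonDyer.Rank1Residual.O5

end
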